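import Literature.AlgebraicGeometry.Resolution.GeneralLU
import Literature.AlgebraicGeometry.Resolution.ArithmeticalThreefoldsLocal
import Mathlib.AlgebraicGeometry.ResidueField
import HarnessLib

/-!
# Temkin's desingularization of quasi-excellent schemes in characteristic zero, and (LU) in
# residue characteristic zero

Topic: `Literature/AlgebraicGeometry/Resolution`. The leaf `CossartPiltant2019LUCompleteChar0`
of the decomposition of `CossartPiltant2019` (`ArithmeticalThreefoldsLocal.lean`: Cossart–Piltant's
(LU) for complete Noetherian local domains of dimension three whose residue field has
characteristic `0` — in the source a one-line appeal to "the equicharacteristic zero version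
of theorem 1.1 being known") is re-rooted here in the published theorem it rests on:

* `Temkin2008` — NAMED FACT, Temkin 2008, Thm. 1.1 (i)⇒(ii) (with Thm. 2.3.6, from Hironaka):
  a Noetherian, quasi-excellent, integral scheme whose residue fields have characteristic zero
  admits a desingularization; vendored in the weak form `Scheme.HasResolution` of this topic.
* PROVED: `charZero_of_ringHom_of_isUnit_natCast`, `isUnit_natCast_of_charZero_residueField`
  (a local ring with residue field of characteristic `0` contains `ℚ`),
  `charZero_residueField_spec` (then all residue fields of `Spec A` have characteristic `0`);
  `Temkin2008.hasResolution_spec` (resolution of `Spec A` for quasi-excellent domains `A ⊇ ℚ`,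
  uses `Stacks07QU` to see that `Spec A` is a quasi-excellent *scheme*),
  `Temkin2008.cpLocalUniformization` ((LU) for quasi-excellent local domains of residue
  characteristic `0`, any dimension, by the valuative criterion `exists_fg_regular_of_hasResolution`),
  `luCompleteChar0_of_temkin2008 : Temkin2008 → Stacks07QU → Stacks07QW_complete →
  CossartPiltant2019LUCompleteChar0`, and the re-rooted assembly `cossartPiltant2019_of_local'`.

## Sources

* M. Temkin, *Desingularization of quasi-excellent schemes in characteristic zero*, Adv. Math.
  219 (2008) 488–522 = arXiv:math/0703678, Thm. 1.1 and Thm. 2.3.6; p. 3: "The scheme `X` is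
  said to admit a resolution of singularities if there exists a blow-up `X' → X` with center
  disjoint from `X_reg` and regular `X'`" … "resolution of singularities for arbitrary
  quasi-excellent schemes with residue fields of characteristic zero". [Temkin2008]
* V. Cossart, O. Piltant, J. Algebra 529 (2019), proof of Prop. 4.10 (arXiv v1: 4.8), first
  paragraph. [CossartPiltant2019]
* The Stacks Project, Tags 07QU, 07QW. [StacksProject]
-/

noncomputable section

open CategoryTheory AlgebraicGeometry TopologicalSpace IsLocalRing

namespace Literature.AlgebraicGeometry.Resolution

universe u

/-! ## Rings containing `ℚ` -/

/-- A nontrivial ring receiving a homomorphism from a ring in which every nonzero natural number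
is a unit has characteristic zero. [folklore] -/
theorem charZero_of_ringHom_of_isUnit_natCast {A B : Type*} [CommRing A] [CommRing B]
    [Nontrivial B] (f : A →+* B) (h : ∀ n : ℕ, n ≠ 0 → IsUnit (n : A)) : CharZero B := by
  refine ⟨fun m n hmn => ?_⟩
  by_contra hne
  wlog hlt : m < n generalizing m n
  · exact this n m hmn.symm (Ne.symm hne) (lt_of_le_of_ne (not_lt.mp hlt) (Ne.symm hne))
  have hk : n - m ≠ 0 := Nat.sub_ne_zero_of_lt hlt
  have hu : IsUnit ((n - m : ℕ) : B) := by
    have := (h (n - m) hk).map f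
    simpa using this
  have h0 : ((n - m : ℕ) : B) = 0 := by
    rw [Nat.cast_sub hlt.le, ← hmn, sub_self]
  exact not_isUnit_zero (h0 ▸ hu)

/-- In a local ring whose residue field has characteristic zero every nonzero natural number is a
unit (it is nonzero in the residue field, hence not in the maximal ideal). [folklore] -/
theorem isUnit_natCast_of_charZero_residueField {A : Type*} [CommRing A] [IsLocalRing A]
    [CharZero (ResidueField A)] (n : ℕ) (hn : n ≠ 0) : IsUnit (n : A) := by
  by_contra hu
  have hmem : (n : A) ∈ maximalIdeal A := hu
  have : (n : ResidueField A) = 0 := by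
    rw [← map_natCast (residue A), residue_eq_zero_iff]
    exact hmem
  exact hn (Nat.cast_eq_zero.mp this)

/-- The residue fields of `Spec A` have characteristic zero when every nonzero natural number is
a unit in `A` (e.g. `A ⊇ ℚ`). [folklore] -/
theorem charZero_residueField_spec {A : Type u} [CommRing A]
    (h : ∀ n : ℕ, n ≠ 0 → IsUnit (n : A)) (x : Spec (.of A)) :
    CharZero ((Spec (.of A)).residueField x) := by
  let e : A ≃+* Γ(Spec (.of A), ⊤) := (Scheme.ΓSpecIso (.of A)).commRingCatIsoToRingEquiv.symm
  let f : A →+* (Spec (.of A)).residueField x :=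
    ((Spec (.of A)).evaluation ⊤ x trivial).hom.comp e.toRingHom
  exact charZero_of_ringHom_of_isUnit_natCast f h

/-! ## Temkin's theorem -/

/-- NAMED FACT — **Temkin 2008, Thm. 1.1 (i)⇒(ii)** ("Let `X` be a noetherian scheme of
characteristic zero, then the following conditions are equivalent: (i) `X` is quasi-excellent;
(ii) any integral scheme of finite type over `X` admits a desingularization", a
desingularization being "a blow-up `X' → X` with center disjoint from `X_reg` and regular `X'`";
the not-embedded case is also ibid. Thm. 2.3.6, deduced from Hironaka 1964), applied to `X`
itself and vendored in the weak form of this topic: every Noetherian, quasi-excellent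
(`Scheme.IsQuasiExcellent`: all affine opens have quasi-excellent coordinate rings), integral
scheme all of whose residue fields have characteristic zero admits a proper birational morphism
from a regular scheme (`Scheme.HasResolution`; a blow-up of an integral Noetherian scheme along a
centre missing the generic point is proper and birational). Users take `(h : Temkin2008)`.
[cite: Temkin2008, Thm. 1.1 and Thm. 2.3.6] -/
def Temkin2008 : Prop :=
  ∀ (X : Scheme.{u}) [IsIntegral X] [IsNoetherian X], Scheme.IsQuasiExcellent X →
    (∀ x : X, CharZero (X.residueField x)) → Scheme.HasResolution X

/-- Under `Temkin2008` and `Stacks07QU`, `Spec A` has a resolution for every quasi-excellent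
domain `A` in which the nonzero natural numbers are units. [cite: Temkin2008, Thm. 1.1] -/
theorem Temkin2008.hasResolution_spec (h : Temkin2008.{u}) (h07 : Stacks07QU.{u}) (A : Type u)
    [CommRing A] [IsDomain A] (hA : IsQuasiExcellentRing A)
    (hQ : ∀ n : ℕ, n ≠ 0 → IsUnit (n : A)) : Scheme.HasResolution (Spec (.of A)) := by
  haveI : IsNoetherianRing A := hA.isNoetherianRing
  haveI : IsNoetherianRing (CommRingCat.of A) := ‹IsNoetherianRing A›
  haveI : IsDomain (CommRingCat.of A) := ‹IsDomain A›
  haveI : IsNoetherian (Spec (.of A)) := {}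
  have hqe := Scheme.isQuasiExcellent_of_locallyOfFiniteType_of_isQuasiExcellentRing h07 hA
    (𝟙 (Spec (.of A)))
  exact h (Spec (.of A)) hqe (charZero_residueField_spec hQ)

/-- **(LU) in residue characteristic zero from Temkin's theorem**: for every quasi-excellent local
domain `A` whose residue field has characteristic `0` (any dimension), Cossart–Piltant's (LU)
`CPLocalUniformization A` holds — resolve `Spec A` by `Temkin2008` and apply the valuative
criterion (`exists_fg_regular_of_hasResolution`, `ResolutionLU.lean`).
[cite: Temkin2008, Thm. 1.1] [cite: CossartPiltant2019, proof of Prop. 4.10 (arXiv v1: 4.8)] -/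
theorem Temkin2008.cpLocalUniformization (h : Temkin2008.{u}) (h07 : Stacks07QU.{u}) (A : Type u)
    [CommRing A] [IsDomain A] [IsLocalRing A] (hA : IsQuasiExcellentRing A)
    (h0 : CharZero (ResidueField A)) : CPLocalUniformization A := by
  intro K _ _ _ O hAO _ _
  obtain ⟨T, hT, ⟨s, rfl⟩, hreg⟩ := exists_fg_regular_of_hasResolution O hAO
    (h.hasResolution_spec h07 A hA (isUnit_natCast_of_charZero_residueField (A := A)))
  exact ⟨s, hT, hreg⟩

/-- **`CossartPiltant2019LUCompleteChar0` from Temkin's theorem**: complete Noetherian local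
rings are excellent (`Stacks07QW_complete`), so `Temkin2008` (with `Stacks07QU`) gives (LU) for
complete local domains of dimension three and residue characteristic zero — the leaf of
`ArithmeticalThreefoldsLocal.lean` re-rooted in the published theorem it abbreviates.
[cite: Temkin2008, Thm. 1.1] [cite: CossartPiltant2019, proof of Prop. 4.10 (arXiv v1: 4.8)] -/
theorem luCompleteChar0_of_temkin2008 (h : Temkin2008.{u}) (h07 : Stacks07QU.{u})
    (h07c : Stacks07QW_complete.{u}) : CossartPiltant2019LUCompleteChar0.{u} := by
  intro A _ _ _ _ _ _ h0
  exact h.cpLocalUniformization h07 A (h07c A).isQuasiExcellentRing h0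

/-- **Assembly with the characteristic-zero leaf re-rooted**: the local theorem (journal Thm. 1.5,
weak form), the reduction in residue characteristic `p`, Temkin 2008 with the excellence facts,
descent (journal Prop. 4.8), surface resolution and patching (journal Prop. 4.6) give
`CossartPiltant2019`. [cite: CossartPiltant2019, Ch. 4] -/
theorem cossartPiltant2019_of_local' (hloc : CossartPiltant2019Local.{u})
    (hred : CossartPiltant2019ReductionP.{u}) (hT : Temkin2008.{u}) (h07 : Stacks07QU.{u})
    (h07c : Stacks07QW_complete.{u}) (h48 : CossartPiltant2019LU3OfComplete.{u})
    (hCJS : CossartJannsenSaito2020.{u}) (hP : CossartPiltant2019Patching.{u}) :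
    CossartPiltant2019.{u} :=
  cossartPiltant2019_of_local hloc hred (luCompleteChar0_of_temkin2008 hT h07 h07c) h48 hCJS hP

end Literature.AlgebraicGeometry.Resolution

end
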